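import Summits.ResolutionOfSingularities.ResolutionOfSingularities.Theorems.PurelyInseparableDim4ChartBoundary
import Literature.AlgebraicGeometry.Resolution.MarkedIdealsLemmas
import HarnessLib

/-!
# Purely inseparable four-folds `z^p + F(x₁, …, x₄)`: TWISTED GENERATORS of the centre ideal on the
# re-centred chart (brick TY-2 (h) «chart chain», part 1 of the closedness criterion, cell `res-dim4-pi`)

[OURS · counted 0] (D-0157 DOOR 2; director-resolution DR-157-C; frame
`PIDim4.TerminationImpliesOrderReduction`, part S3 (c) «local branches ⇒ global sequence»; typ-3 memo
§B (c4) «GLOBAL centre for the next move»). Setting (files `PurelyInseparableDim4ChartTransfer/Step/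
Boundary.lean`): `K` a field, `P = 𝔸⁵_K`, a coordinate centre `V(z, x_S)` with ideal sheaf `𝓘Λ 4 K Λ_S`
(`Λ_S = insert 0 (Fin.succ '' S)`), ANY blowing up `π : W → P` along it, the `x_j`-chart
`chartImm : 𝔸⁵_K ⟶ W` (`j ∈ S`, chart substitution `ψ = coordBlowupSubst`) and a re-centring
automorphism `Θ` of `K[z, x]` of the shape produced by the dictionary (`Θ z = z + h(x)`, `Θ xᵢ = xᵢ + bᵢ`,
`b_j = 0`). The walk's NEXT centre is a coordinate subspace `V(z, x_{S'})` of the re-centred chart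
`φ = Spec Θ ≫ chartImm`; the sequel `PurelyInseparableDim4ChartCentreClosed.lean` proves that its image is
CLOSED in `W` when `S ∖ {j} ⊆ S'`, by exhibiting TWISTED GENERATORS of the centre ideal `(z, x_S)` whose
principal charts avoid it. This file is the ring-level and principal-chart half. PROVED (no `sorry`, no
new axiom):

* §1 `sub_aeval_mem_span_X_image` (`h − h|_{x_{S'}=0} ∈ (x_{S'})`); the twisted cleaning polynomial
  `G = h(σ x)` (`σ_k = 0` for `k ∈ S'`, `x_k − b_k` otherwise): `aeval_add_C_twist` (`G(x + b) = h|_{x_{S'}=0}`),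
  `coordBlowupSubst_twist` (`ψ G = G` when `S ∖ {j} ⊆ S'`); the chart identities
  `clean_subst_X_sub` (`Θ(ψ(xᵢ − bᵢ x_j)) = x_j · xᵢ`, `i ∈ S ∖ j`) and
  `clean_subst_X_zero_sub` (`Θ(ψ(z − x_j G)) = x_j · (z + (h − h|_{x_{S'}=0}))`), the membership
  `X_zero_add_rename_sub_mem_IΛ` (`z + (h − h|_{x_{S'}=0}) ∈ (z, x_{S'})`), and
  **`span_twist_eq_IΛ`**: `(z − x_j G, x_j, xᵢ − bᵢ x_j (i ∈ S ∖ j)) = (z, x_S)` — the twisted elements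
  generate the centre ideal;
* §2 **`not_mem_support_colon_of_mem_blowupChart`** — on the principal chart `X'[⊤, u]` of a blowing
  up `π : X' → X` (`X` affine) for a global section `u` of the centre ideal `I`, the colon ideal sheaf
  `(π^*(u·𝒪) : π^*I)` is the unit ideal (`π^*I = (π^*u)` there, Stacks 0804), so the chart misses its
  support.

Nothing here is a statement about resolution of singularities in dimension ≥ 4 / characteristic `p`
(NOT proved anywhere in this programme). bears_on: LADDER-RESOLUTION:D157-DOOR2 (res-dim4-pi). Supports
stmt-ResolutionOfSingularities-16155 (helper, TY-2 (h)).
-/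

-- every declaration of this summit lives under `Summit.ResolutionOfSingularities.ResolutionOfSingularities`
-- (summit = problem), which the duplicate-namespace linter flags; house convention (cf. the Target file).
set_option linter.dupNamespace false

noncomputable section

open MvPolynomial Finset CategoryTheory AlgebraicGeometry Opposite TopologicalSpace
open AlgebraicGeometry.Scheme.IdealSheafData (ofIdealTop vanishingIdeal)

namespace Summit.ResolutionOfSingularities.ResolutionOfSingularities.Theorems.PIDim4

open Literature.AlgebraicGeometry.Resolution
open Literature.AlgebraicGeometry.Resolution.AffinePointBlowup (P A γ coord Wtop)

namespace ChartDictionary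

/-! ## §1 Ring level: the twisted generators of the centre ideal -/

section Ring

variable {K : Type} [Field K]

/-- `h − h|_{x_T = 0} ∈ (x_k : k ∈ T)`: killing the variables of `T` changes a polynomial by an
element of the ideal they generate. -/
theorem sub_aeval_mem_span_X_image (T : Finset (Fin 4)) (h : MvPolynomial (Fin 4) K) :
    h - aeval (fun k => if k ∈ T then (0 : MvPolynomial (Fin 4) K) else X k) h ∈
      Ideal.span (X '' (T : Set (Fin 4)) : Set (MvPolynomial (Fin 4) K)) := by
  classical
  set J : Ideal (MvPolynomial (Fin 4) K) := Ideal.span (X '' (T : Set (Fin 4))) with hJ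
  rw [← Ideal.Quotient.eq]
  have key : (Ideal.Quotient.mkₐ K J).comp
      (aeval fun k => if k ∈ T then (0 : MvPolynomial (Fin 4) K) else X k) = Ideal.Quotient.mkₐ K J := by
    refine MvPolynomial.algHom_ext fun k => ?_
    rw [AlgHom.comp_apply, aeval_X]
    by_cases hk : k ∈ T
    · rw [if_pos hk, map_zero, Ideal.Quotient.mkₐ_eq_mk, eq_comm, Ideal.Quotient.eq_zero_iff_mem]
      exact Ideal.subset_span ⟨k, hk, rfl⟩
    · rw [if_neg hk]
  have := congrArg (fun f : MvPolynomial (Fin 4) K →ₐ[K] MvPolynomial (Fin 4) K ⧸ J => f h) key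
  simpa only [AlgHom.comp_apply, Ideal.Quotient.mkₐ_eq_mk] using this.symm

/-- The twisted cleaning polynomial read back at the point: substituting `x ↦ x + b` into
`G = h(σ x)` (`σ_k = 0` on `T`, `x_k − b_k` off `T`) gives `h|_{x_T = 0}`. -/
theorem aeval_add_C_twist (T : Finset (Fin 4)) (b : Fin 4 → K) (h : MvPolynomial (Fin 4) K) :
    aeval (fun k => (X k + C (b k) : MvPolynomial (Fin 4) K))
        (aeval (fun k => if k ∈ T then (0 : MvPolynomial (Fin 4) K) else X k - C (b k)) h) =
      aeval (fun k => if k ∈ T then (0 : MvPolynomial (Fin 4) K) else X k) h := by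
  have hc : (aeval fun k => (X k + C (b k) : MvPolynomial (Fin 4) K)).comp
      (aeval fun k => if k ∈ T then (0 : MvPolynomial (Fin 4) K) else X k - C (b k)) =
      aeval fun k => if k ∈ T then (0 : MvPolynomial (Fin 4) K) else X k := by
    refine MvPolynomial.algHom_ext fun k => ?_
    rw [AlgHom.comp_apply, aeval_X, aeval_X]
    by_cases hk : k ∈ T
    · rw [if_pos hk, if_pos hk, map_zero]
    · rw [if_neg hk, if_neg hk, map_sub, aeval_X, aeval_C, algebraMap_eq, add_sub_cancel_right]
  rw [← AlgHom.comp_apply, hc]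

/-- A re-centring/cleaning automorphism (`Θ xᵢ = xᵢ + bᵢ`) acts on the base variables as the
translation: `Θ (G(x)) = G(x + b)`. -/
theorem clean_rename_eq_rename_aeval {Θ : A 4 K ≃ₐ[K] A 4 K} {b : Fin 4 → K}
    (hs : ∀ i : Fin 4, Θ (X i.succ) = X i.succ + C (b i)) (G : MvPolynomial (Fin 4) K) :
    Θ (rename Fin.succ G) = rename Fin.succ (aeval (fun k => (X k + C (b k) : MvPolynomial (Fin 4) K)) G) := by
  have hc : (Θ : A 4 K →ₐ[K] A 4 K).comp (rename Fin.succ) =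
      (rename Fin.succ).comp (aeval fun k => (X k + C (b k) : MvPolynomial (Fin 4) K)) := by
    refine MvPolynomial.algHom_ext fun k => ?_
    rw [AlgHom.comp_apply, AlgHom.comp_apply, rename_X, aeval_X, map_add, rename_X, rename_C]
    exact hs k
  exact congrArg (fun f : MvPolynomial (Fin 4) K →ₐ[K] A 4 K => f G) hc

/-- The chart substitution of `C_S` fixes the twisted polynomial `G = h(σ x)` when `S ∖ {j} ⊆ S'`
(`G` involves only variables off `S'`, all fixed by `ψ`). -/
theorem coordBlowupSubst_twist {S S' : Finset (Fin 4)} {j : Fin 4} (hS' : S.erase j ⊆ S')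
    (b : Fin 4 → K) (h : MvPolynomial (Fin 4) K) :
    coordBlowupSubst K (S : Set (Fin 4)) j
        (aeval (fun k => if k ∈ S' then (0 : MvPolynomial (Fin 4) K) else X k - C (b k)) h) =
      aeval (fun k => if k ∈ S' then (0 : MvPolynomial (Fin 4) K) else X k - C (b k)) h := by
  have hc : (coordBlowupSubst K (S : Set (Fin 4)) j).comp
      (aeval fun k => if k ∈ S' then (0 : MvPolynomial (Fin 4) K) else X k - C (b k)) =
      aeval fun k => if k ∈ S' then (0 : MvPolynomial (Fin 4) K) else X k - C (b k) := by
    refine MvPolynomial.algHom_ext fun k => ?_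
    rw [AlgHom.comp_apply, aeval_X]
    by_cases hk : k ∈ S'
    · rw [if_pos hk, map_zero]
    · have hkS : ¬ (k ∈ (S : Set (Fin 4)) ∧ k ≠ j) := fun hc =>
        hk (hS' (Finset.mem_erase.mpr ⟨hc.2, hc.1⟩))
      rw [if_neg hk, map_sub, coordBlowupSubst_X, if_neg hkS, coordBlowupSubst_C]
  rw [← AlgHom.comp_apply, hc]

/-- On the `x_j`-chart of `Bl_{V(z, x_S)} 𝔸⁵`, re-centred at `b` (`b_j = 0`): the hyperplane
`xᵢ − bᵢ x_j` (`i ∈ S ∖ j`, through the centre) pulls back to `x_j · xᵢ` — exceptional factor times the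
coordinate `xᵢ` of the new chart. -/
theorem clean_subst_X_sub (S : Finset (Fin 4)) {i j : Fin 4} (hi : i ∈ S) (hij : i ≠ j)
    {Θ : A 4 K ≃ₐ[K] A 4 K} {b : Fin 4 → K} (hbj : b j = 0)
    (hs : ∀ i : Fin 4, Θ (X i.succ) = X i.succ + C (b i)) :
    Θ (coordBlowupSubst K (insert 0 (Fin.succ '' (S : Set (Fin 4)))) j.succ
        (X i.succ - C (b i) * X j.succ)) = X j.succ * X i.succ := by
  have hψi : coordBlowupSubst K (insert 0 (Fin.succ '' (S : Set (Fin 4)))) j.succ (X i.succ) =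
      X j.succ * X i.succ :=
    coordBlowupSubst_X_of_mem_of_ne K _ j.succ (succ_mem_centreVars hi) (fun h => hij (Fin.succ_inj.mp h))
  have hC : Θ (C (b i)) = C (b i) := Θ.commutes (b i)
  rw [map_sub, map_mul, coordBlowupSubst_C, coordBlowupSubst_X_self, hψi, map_sub, map_mul, map_mul,
    hs i, hs j, hbj, C_0, add_zero, hC]
  ring

/-- On the `x_j`-chart, re-centred at `b` and cleaned by `h`: the hypersurface `z − x_j · G` (through the
centre; `G = h(σ x)` the twisted cleaning polynomial) pulls back to `x_j · (z + (h − h|_{x_{S'}=0}))`. -/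
theorem clean_subst_X_zero_sub {S S' : Finset (Fin 4)} {j : Fin 4} (hS' : S.erase j ⊆ S')
    {Θ : A 4 K ≃ₐ[K] A 4 K} {b : Fin 4 → K} {h : MvPolynomial (Fin 4) K} (hbj : b j = 0)
    (h0 : Θ (X 0) = X 0 + rename Fin.succ h) (hs : ∀ i : Fin 4, Θ (X i.succ) = X i.succ + C (b i)) :
    Θ (coordBlowupSubst K (insert 0 (Fin.succ '' (S : Set (Fin 4)))) j.succ
        (X 0 - X j.succ * rename Fin.succ
          (aeval (fun k => if k ∈ S' then (0 : MvPolynomial (Fin 4) K) else X k - C (b k)) h))) =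
      X j.succ * (X 0 + rename Fin.succ
        (h - aeval (fun k => if k ∈ S' then (0 : MvPolynomial (Fin 4) K) else X k) h)) := by
  rw [map_sub, map_mul, coordBlowupSubst_X_self, coordBlowupSubst_centreVars_X_zero,
    coordBlowupSubst_centreVars_rename, coordBlowupSubst_twist hS', map_sub, map_mul, map_mul, h0, hs j,
    hbj, C_0, add_zero, clean_rename_eq_rename_aeval hs, aeval_add_C_twist, map_sub]
  ring

/-- The second factor lies in the ideal of the next centre: `z + (h − h|_{x_{S'}=0}) ∈ (z, x_{S'})`. -/
theorem X_zero_add_rename_sub_mem_IΛ (S' : Finset (Fin 4)) (h : MvPolynomial (Fin 4) K) :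
    X 0 + rename Fin.succ (h - aeval (fun k => if k ∈ S' then (0 : MvPolynomial (Fin 4) K) else X k) h) ∈
      AffineCoordBlowup.IΛ 4 K (insert 0 (Fin.succ '' (S' : Set (Fin 4)))) := by
  refine Ideal.add_mem _ (Ideal.subset_span ⟨0, Set.mem_insert _ _, rfl⟩) ?_
  have hmap : (Ideal.span (X '' (S' : Set (Fin 4)) : Set (MvPolynomial (Fin 4) K))).map
      (rename Fin.succ : MvPolynomial (Fin 4) K →ₐ[K] A 4 K) ≤
      AffineCoordBlowup.IΛ 4 K (insert 0 (Fin.succ '' (S' : Set (Fin 4)))) := by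
    rw [Ideal.map_span, Ideal.span_le]
    rintro _ ⟨_, ⟨k, hk, rfl⟩, rfl⟩
    exact Ideal.subset_span ⟨k.succ, Set.mem_insert_of_mem _ ⟨k, hk, rfl⟩, (rename_X _ _).symm⟩
  exact hmap (Ideal.mem_map_of_mem _ (sub_aeval_mem_span_X_image S' h))

/-- **The twisted generators generate the centre ideal**: in `K[z, x]`,
`(z − x_j G, xᵢ − bᵢ x_j (i ∈ S ∖ j), x_j) = (z, x_S)` (a unimodular change of generators). -/
theorem span_twist_eq_IΛ (S : Finset (Fin 4)) {j : Fin 4} (hj : j ∈ S) (b : Fin 4 → K)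
    (Gt : MvPolynomial (Fin (4 + 1)) K) :
    Ideal.span (insert (X 0 - X j.succ * Gt) (insert (X j.succ)
        ((fun i : Fin 4 => (X i.succ - C (b i) * X j.succ : A 4 K)) '' (S.erase j : Set (Fin 4))))) =
      AffineCoordBlowup.IΛ 4 K (insert 0 (Fin.succ '' (S : Set (Fin 4)))) := by
  apply le_antisymm
  · rw [Ideal.span_le]
    have hXj : (X j.succ : A 4 K) ∈ AffineCoordBlowup.IΛ 4 K (insert 0 (Fin.succ '' (S : Set (Fin 4)))) :=
      Ideal.subset_span ⟨j.succ, Set.mem_insert_of_mem _ ⟨j, hj, rfl⟩, rfl⟩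
    rintro f (rfl | rfl | ⟨i, hi, rfl⟩)
    · exact Ideal.sub_mem _ (Ideal.subset_span ⟨0, Set.mem_insert _ _, rfl⟩) (Ideal.mul_mem_right _ _ hXj)
    · exact hXj
    · refine Ideal.sub_mem _ (Ideal.subset_span ⟨i.succ, Set.mem_insert_of_mem _
        ⟨i, Finset.mem_of_mem_erase hi, rfl⟩, rfl⟩) (Ideal.mul_mem_left _ _ hXj)
  · rw [Ideal.span_le]
    set J : Ideal (A 4 K) := Ideal.span (insert (X 0 - X j.succ * Gt) (insert (X j.succ)
        ((fun i : Fin 4 => (X i.succ - C (b i) * X j.succ : A 4 K)) '' (S.erase j : Set (Fin 4))))) with hJ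
    have hXj : (X j.succ : A 4 K) ∈ J := Ideal.subset_span (Set.mem_insert_of_mem _ (Set.mem_insert _ _))
    rintro _ ⟨l, hl, rfl⟩
    rcases hl with rfl | ⟨i, hi, rfl⟩
    · have h1 : (X 0 - X j.succ * Gt : A 4 K) ∈ J := Ideal.subset_span (Set.mem_insert _ _)
      have h2 : (X 0 : A 4 K) = (X 0 - X j.succ * Gt) + X j.succ * Gt := by ring
      rw [h2]
      exact Ideal.add_mem _ h1 (Ideal.mul_mem_right _ _ hXj)
    · by_cases hij : i = j
      · subst hij
        exact hXj
      · have h1 : (X i.succ - C (b i) * X j.succ : A 4 K) ∈ J :=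
          Ideal.subset_span (Set.mem_insert_of_mem _ (Set.mem_insert_of_mem _
            ⟨i, Finset.mem_erase.mpr ⟨hij, hi⟩, rfl⟩))
        have h2 : (X i.succ : A 4 K) = (X i.succ - C (b i) * X j.succ) + C (b i) * X j.succ := by ring
        rw [h2]
        exact Ideal.add_mem _ h1 (Ideal.mul_mem_left _ _ hXj)

end Ring

/-! ## §2 The colon ideal sheaf `(π^*(u) : π^*𝓘)` has no support on the principal chart of `u` -/

section PrincipalChart

universe u

variable {X' X : Scheme.{u}} {π : X' ⟶ X} {I : X.IdealSheafData}

/-- **No support on the principal chart.** For `X` affine, a global section `u` and a point `w` of the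
principal chart `X'[⊤, u]` of `π : X' → X` for `I` (there `π^*I` is generated by the regular element
`π^*u`, Stacks 0804): the colon ideal sheaf `(π^*(u·𝒪_X) : π^*I)` is the unit ideal near `w`, so `w`
is not in its support. -/
theorem not_mem_support_colon_of_mem_blowupChart [IsAffine X] [IsLocallyNoetherian X'] {u : Γ(X, ⊤)}
    {w : X'} (hw : w ∈ blowupChart π I ⟨⊤, isAffineOpen_top X⟩ u) :
    w ∉ (colon ((ofIdealTop (Ideal.span {u})).comap π) (I.comap π)).support := by
  obtain ⟨V, ⟨hle, -, hideal⟩, hwV⟩ := mem_blowupChart_iff.mp hw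
  rw [Scheme.IdealSheafData.mem_support_iff_of_mem hwV, ideal_colon]
  have hL : ((ofIdealTop (Ideal.span {u})).comap π).ideal V =
      Ideal.span {π.appLE (⊤ : X.Opens) V hle u} := by
    rw [ideal_comap_of_le π _ ⟨⊤, isAffineOpen_top X⟩ V hle, ideal_ofIdealTop_top, Ideal.map_span,
      Set.image_singleton]
  have htop : (((ofIdealTop (Ideal.span {u})).comap π).ideal V).colon
      (((I.comap π).ideal V : Ideal Γ(X', V)) : Set Γ(X', V)) = ⊤ := by
    rw [hL, hideal, Ideal.eq_top_iff_one]
    exact Submodule.mem_colon.mpr fun s hs => by rwa [one_smul]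
  rw [htop]
  intro hz
  have h1 := (X'.mem_zeroLocus_iff _ w).mp hz 1 Submodule.mem_top
  rw [Scheme.basicOpen_one] at h1
  exact h1 hwV

end PrincipalChart

end ChartDictionary

end Summit.ResolutionOfSingularities.ResolutionOfSingularities.Theorems.PIDim4

end
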